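import Summits.ResolutionOfSingularities.ResolutionOfSingularities.Theorems.FrobeniusLadderFInjectiveMacaulayficationCoactionReesAway
import HarnessLib

/-!
# `A' ≅ T[Y, Y⁻¹]` for an abstract model `T` of the degree-zero part (crux `FInjectiveMacaulayfication`, H-G2 abstract, III)

Support file for crux stmt-ResolutionOfSingularities-15315 (`FrobeniusLadder.FInjectiveMacaulayfication`,
registered skeleton v11 `86e9127b`, line `graded-engine`, §16 G4 `stub_gradedChartClause`). [OURS · L1 W4.5a]

`…CoactionReesAway.exists_awayEquiv` produces the isomorphism `e : (↥T₀)[Y][1/Y] ≃+* A'` for the degree-`0`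
SUBALGEBRA `T₀ ⊆ L[X]`. The G4 assembly `GradedChartClauseAssembly.chartClause_of_reesInterface` (stub-2, p481897)
takes instead an ABSTRACT ring `(T₀ : Type) [CommRing T₀]` and `e : Localization.Away (X : T₀[X]) ≃+* A'`; feeding it
the subalgebra `↥T₀` makes Lean compare the ring structure SYNTHESISED on `↥T₀` with the one DERIVED from
`CommRing ↥T₀` inside the type `Localization.Away (X : (↥T₀)[X])` — definitionally equal but, over the concrete
weighted-blow-up rings, not within any reasonable heartbeat budget (measured: > 3·10⁶). This file therefore restates the
isomorphism for an abstract commutative ring `T` given with an injective ring map `j : T →+* L[X]` whose range is the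
degree-`0` part; all structure on `T[X]` and its localisation is then derived from the single instance `CommRing T`,
exactly as in the consumer, and instantiation (`T := ↥T₀`, `j := T₀.val`) is syntactically consistent.

* `exists_awayEquiv_of_range` — `e : Localization.Away (X : T[X]) ≃+* A'` with `e (C t) = j t` and `e X = C U`, for a
  homogeneous unit `U` of degree `N > 0` (same proof as `exists_awayEquiv`: injectivity by independence of homogeneous
  elements of the distinct degrees `m + dN`, surjectivity by decomposing into components).

Folklore; no definitions, no named facts.
-/

-- single-problem summit: the doubled namespace component is forced
set_option linter.dupNamespace false

noncomputable section

open scoped LaurentPolynomial Polynomial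
open AddMonoidAlgebra LaurentPolynomial
open Summit.ResolutionOfSingularities.ResolutionOfSingularities.Theorems.FInjectiveMacaulayfication
open Summit.ResolutionOfSingularities.ResolutionOfSingularities.Theorems.FInjectiveMacaulayfication.LaurentCoaction
open Summit.ResolutionOfSingularities.ResolutionOfSingularities.Theorems.FInjectiveMacaulayfication.CoactionRees

namespace Summit.ResolutionOfSingularities.ResolutionOfSingularities.Theorems.FInjectiveMacaulayfication.CoactionReesAwayRange

variable {k L : Type} [Field k] [CommRing L] [Algebra k L] (β : L →+* L[T;T⁻¹])
  (hε : ∀ ℓ : L, LaurentPolynomial.eval₂ (RingHom.id L) 1 (β ℓ) = ℓ)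
  (hΔ : ∀ (ℓ : L) (i : ℤ), β ((β ℓ).coeff i) = single i ((β ℓ).coeff i))
  (N : ℕ) (T : Type) [CommRing T] (j : T →+* L[X]) (hj : Function.Injective j) (A' : Subalgebra k L[X])
  (hT : ∀ q : L[X], q ∈ Set.range j ↔ ∀ m : ℕ, β (q.coeff m) = single (m : ℤ) (q.coeff m))
  (hA' : ∀ q : L[X], q ∈ A' ↔ ∀ m : ℕ,
    (mapDomainRingHom L (Int.castAddHom (ZMod N))).comp β (q.coeff m) = single (m : ZMod N) (q.coeff m))

include hT hA' in
/-- The range of `j` (the degree-`0` part) lies in the Veronese subalgebra `A'`. [folklore] -/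
theorem range_le_veronese (t : T) : j t ∈ A' := (hA' _).mpr fun m => by
  rw [hom_zmod β N ((hT (j t)).mp ⟨t, rfl⟩ m), Int.cast_natCast]

include hT in
/-- Monomials `C ℓ * X ^ m` with `ℓ` homogeneous of degree `m` lie in the range of `j`. [folklore] -/
theorem exists_eq_C_mul_X_pow {ℓ : L} {m : ℕ} (hℓ : β ℓ = single (m : ℤ) ℓ) :
    ∃ t : T, j t = Polynomial.C ℓ * Polynomial.X ^ m := by
  refine (hT _).mpr fun m' => ?_
  rw [Polynomial.coeff_C_mul_X_pow]
  split_ifs with h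
  · rw [h]; exact hℓ
  · exact hom_zero β _

include hε hΔ hj hT hA' in
/-- **`A'` is the Laurent polynomial ring over the degree-zero part, abstract-model form.** For `T` a commutative
ring with an injective ring map `j : T →+* L[X]` onto the degree-`0` part and a unit `U` of `L` homogeneous of degree
`N > 0`, there is a ring isomorphism `e : (T[X])[1/X] ≃+* A'` with `e (C t) = j t` and `e X = C U`. [folklore] -/
theorem exists_awayEquiv_of_range (hN : 0 < N) (U V : L) (hUV : U * V = 1) (hU : β U = single (N : ℤ) U) :
    ∃ e : Localization.Away (Polynomial.X : Polynomial T) ≃+* A',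
      (∀ t : T, ((e (algebraMap (Polynomial T) (Localization.Away (Polynomial.X : Polynomial T))
        (Polynomial.C t)) : A') : L[X]) = j t) ∧
      ((e (algebraMap (Polynomial T) (Localization.Away (Polynomial.X : Polynomial T))
        Polynomial.X) : A') : L[X]) = Polynomial.C U := by
  classical
  have hjA : ∀ t : T, j t ∈ A' := range_le_veronese β N T j A' hT hA'
  have hV : β V = single (-(N : ℤ)) V := hom_of_mul_eq_one hUV hU
  have hCU : Polynomial.C U ∈ A' := C_mem_veronese β N A' hA' hU (dvd_refl _)
  have hCV : Polynomial.C V ∈ A' := C_mem_veronese β N A' hA' hV (dvd_neg.mpr (dvd_refl _))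
  let x : A' := ⟨Polynomial.C U, hCU⟩
  let y : A' := ⟨Polynomial.C V, hCV⟩
  have hxy : x * y = 1 := Subtype.ext (by
    show Polynomial.C U * Polynomial.C V = 1
    rw [← map_mul, hUV, map_one])
  let i : T →+* A' := j.codRestrict A' hjA
  have hi : ∀ t : T, ((i t : A') : L[X]) = j t := fun t => rfl
  let g : Polynomial T →+* A' := Polynomial.eval₂RingHom i x
  have hgC : ∀ t : T, g (Polynomial.C t) = i t := fun t => Polynomial.eval₂_C _ _
  have hgX : g Polynomial.X = x := Polynomial.eval₂_X _ _
  have hunit : IsUnit (g Polynomial.X) := by rw [hgX]; exact .of_mul_eq_one y hxy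
  let e₀ : Localization.Away (Polynomial.X : Polynomial T) →+* A' := IsLocalization.Away.lift Polynomial.X hunit
  have he₀ : ∀ P : Polynomial T, e₀ (algebraMap _ _ P) = g P := fun P => IsLocalization.Away.lift_eq _ hunit P
  -- `g` is injective: homogeneous elements of the distinct degrees `m + d N` are independent
  have hginj : ∀ P : Polynomial T, g P = 0 → P = 0 := by
    intro P hP
    have hval : ((g P : A') : L[X]) = ∑ d ∈ P.support, j (P.coeff d) * Polynomial.C (U ^ d) := by
      show ((Polynomial.eval₂ i x P : A') : L[X]) = _
      rw [Polynomial.eval₂_eq_sum, Polynomial.sum, AddSubmonoidClass.coe_finsetSum]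
      refine Finset.sum_congr rfl fun d _ => ?_
      rw [Subalgebra.coe_mul, Subalgebra.coe_pow, map_pow]
      rfl
    have hcoef : ∀ m : ℕ, ∑ d ∈ P.support, (j (P.coeff d)).coeff m * U ^ d = 0 := by
      intro m
      have h := congr_arg (fun q : L[X] => q.coeff m) hval
      simp only [hP, Subalgebra.coe_zero, Polynomial.coeff_zero, Polynomial.finsetSum_coeff,
        Polynomial.coeff_mul_C] at h
      exact h.symm
    have hzero : ∀ d ∈ P.support, ∀ m : ℕ, (j (P.coeff d)).coeff m = 0 := by
      intro d hd m
      have hdeg : ∀ d' ∈ P.support, β ((j (P.coeff d')).coeff m * U ^ d') =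
          single ((m : ℤ) + (d' : ℤ) * N) ((j (P.coeff d')).coeff m * U ^ d') :=
        fun d' _ => hom_mul ((hT _).mp ⟨P.coeff d', rfl⟩ m) (hom_pow hU d')
      have hinj : Set.InjOn (fun d' : ℕ => (m : ℤ) + (d' : ℤ) * N) P.support := by
        intro a _ b _ hab
        have hN' : (N : ℤ) ≠ 0 := by exact_mod_cast hN.ne'
        have : (a : ℤ) = b := mul_right_cancel₀ hN' (by simpa using hab)
        exact_mod_cast this
      have h := eq_zero_of_sum_hom_eq_zero P.support _ _ hinj hdeg (hcoef m) d hd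
      calc (j (P.coeff d)).coeff m = (j (P.coeff d)).coeff m * (U * V) ^ d := by
            rw [hUV, one_pow, mul_one]
        _ = 0 := by rw [mul_pow, ← mul_assoc, h, zero_mul]
    refine Polynomial.ext fun d => ?_
    by_cases hd : d ∈ P.support
    · rw [Polynomial.coeff_zero]
      exact (injective_iff_map_eq_zero j).mp hj _ (Polynomial.ext fun m => by
        rw [hzero d hd m, Polynomial.coeff_zero])
    · rw [Polynomial.coeff_zero]
      exact Polynomial.notMem_support_iff.mp hd
  -- the image of `X⁻¹` is `C V`
  let Xinv : Localization.Away (Polynomial.X : Polynomial T) := IsLocalization.Away.invSelf (Polynomial.X : Polynomial T)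
  have hw : ((e₀ Xinv : A') : L[X]) = Polynomial.C V := by
    have h1 : e₀ (algebraMap (Polynomial T) _ Polynomial.X) * e₀ Xinv = 1 := by
      rw [← map_mul]
      show e₀ (algebraMap _ _ (Polynomial.X : Polynomial T) * IsLocalization.Away.invSelf (Polynomial.X : Polynomial T)) = 1
      rw [IsLocalization.Away.mul_invSelf, map_one]
    rw [he₀, hgX] at h1
    have h2 : e₀ Xinv = y := by
      calc e₀ Xinv = y * x * e₀ Xinv := by rw [mul_comm y x, hxy, one_mul]
        _ = y := by rw [mul_assoc, h1, mul_one]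
    rw [h2]
  -- monomials `C ℓ X^m` with `ℓ` homogeneous of degree `≡ m (mod N)` are attained
  have key : ∀ (ℓ : L) (i' : ℤ) (m : ℕ), β ℓ = single i' ℓ → (N : ℤ) ∣ i' - m →
      ∃ z, ((e₀ z : A') : L[X]) = Polynomial.C ℓ * Polynomial.X ^ m := by
    intro ℓ i' m hℓ hdiv
    obtain ⟨d, hd⟩ := hdiv
    rcases Int.eq_nat_or_neg d with ⟨d', rfl | rfl⟩
    · have hℓ' : β (V ^ d' * ℓ) = single (m : ℤ) (V ^ d' * ℓ) := by
        have h := hom_mul (hom_pow hV d') hℓ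
        have hjm : (d' : ℤ) * -(N : ℤ) + i' = m := by linarith
        rwa [hjm] at h
      obtain ⟨t, ht⟩ := exists_eq_C_mul_X_pow β T j hT hℓ'
      refine ⟨algebraMap _ _ (Polynomial.X ^ d' * Polynomial.C t), ?_⟩
      rw [he₀, map_mul, map_pow, hgX, hgC, Subalgebra.coe_mul, Subalgebra.coe_pow, hi, ht]
      show Polynomial.C U ^ d' * (Polynomial.C (V ^ d' * ℓ) * Polynomial.X ^ m) = _
      rw [← map_pow, ← mul_assoc, ← map_mul, ← mul_assoc, ← mul_pow, hUV, one_pow, one_mul]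
    · have hℓ' : β (U ^ d' * ℓ) = single (m : ℤ) (U ^ d' * ℓ) := by
        have h := hom_mul (hom_pow hU d') hℓ
        have hjm : (d' : ℤ) * (N : ℤ) + i' = m := by linarith
        rwa [hjm] at h
      obtain ⟨t, ht⟩ := exists_eq_C_mul_X_pow β T j hT hℓ'
      refine ⟨Xinv ^ d' * algebraMap _ _ (Polynomial.C t), ?_⟩
      rw [map_mul, map_pow, he₀, hgC, Subalgebra.coe_mul, Subalgebra.coe_pow, hw, hi, ht]
      show Polynomial.C V ^ d' * (Polynomial.C (U ^ d' * ℓ) * Polynomial.X ^ m) = _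
      rw [← map_pow, ← mul_assoc, ← map_mul, ← mul_assoc, ← mul_pow, mul_comm V U, hUV, one_pow, one_mul]
  -- surjectivity: every `a ∈ A'` is the sum of such monomials
  have hsurj : Function.Surjective e₀ := by
    intro a
    suffices h : (a : L[X]) ∈ (e₀.range.map (A'.val : A' →+* L[X])) by
      obtain ⟨b, ⟨z, rfl⟩, hb⟩ := Subring.mem_map.mp h
      exact ⟨z, Subtype.ext hb⟩
    have hdec : (a : L[X]) = ∑ m ∈ (a : L[X]).support, ∑ i' ∈ (β ((a : L[X]).coeff m)).coeff.support,
        Polynomial.C ((β ((a : L[X]).coeff m)).coeff i') * Polynomial.X ^ m := by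
      conv_lhs => rw [(a : L[X]).as_sum_support_C_mul_X_pow]
      refine Finset.sum_congr rfl fun m _ => ?_
      rw [← Finset.sum_mul, ← map_sum, sum_coeff_eq β hε]
    rw [hdec]
    refine Subring.sum_mem _ fun m _ => Subring.sum_mem _ fun i' hi' => ?_
    obtain ⟨z, hz⟩ := key _ i' m (hΔ _ i')
      (CoactionReesAway.dvd_sub_of_coeff_ne_zero β hΔ N ((hA' _).mp a.2 m) (Finsupp.mem_support_iff.mp hi'))
    exact Subring.mem_map.mpr ⟨e₀ z, ⟨z, rfl⟩, hz⟩
  have hinj : Function.Injective e₀ := by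
    rw [injective_iff_map_eq_zero]
    intro z hz
    induction z using Localization.induction_on with
    | H yy =>
      obtain ⟨P, s⟩ := yy
      rw [Localization.mk_eq_mk'] at hz ⊢
      have h := IsLocalization.mk'_spec (Localization.Away (Polynomial.X : Polynomial T)) P s
      apply_fun e₀ at h
      rw [map_mul, hz, zero_mul, he₀] at h
      rw [hginj P h.symm, IsLocalization.mk'_zero]
  refine ⟨RingEquiv.ofBijective e₀ ⟨hinj, hsurj⟩, fun t => ?_, ?_⟩
  · rw [RingEquiv.ofBijective_apply, he₀, hgC, hi]
  · rw [RingEquiv.ofBijective_apply, he₀, hgX]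

end Summit.ResolutionOfSingularities.ResolutionOfSingularities.Theorems.FInjectiveMacaulayfication.CoactionReesAwayRange

end
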